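import Summits.CriticalPhenomena.PercolationContinuityZ3.Theorems.Transplant.FKConnectivityAllQAntipodalX2SpineDefs
import HarnessLib

/-!
# Connectivity correlation inequalities for `φ_{w,q}` — the spine of a marked edge, file 3: the TWO-TERMINAL SUBSTITUTION lemma
# (a part glued across `a, b` acts on the vertices of the other part like a virtual edge `ab`)

Helper file (`--supports stmt-CriticalPhenomena-4575`), FK sub-lane `prim-bschramm-fk-2` (gen 14); builds on p205010 (kernel
theorem, internal audit signed; external expert review pending).  No definitions, no named facts, no sorries; standard axioms.
Pure combinatorics of open configurations `ω₁ ⊆ E₁`, `ω₂ ⊆ E₂` on edge sets living on vertex sets `V₁`, `V₂` with `V₁ ∩ V₂ ⊆ {a, b}`: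

* `FK.reach_union_subst` — if `N` contains the virtual edge `s(a, b)` whenever `a ↔ b` inside `ω₂` (and `a ≠ b`), then for
  `u, v ∈ V₁`: `u ↔ v` in `ω₁ ∪ ω₂` implies `u ↔ v` in `ω₁ ∪ N` (walk splitting at the separator, `GZGluing.walk_split`: every hop
  through the second part runs between `a` and `b`);
* corollaries `FK.reach_union_virtual` (`N = {ab}`), `FK.reach_left_of_not_reach` (`a ↮ b` in `ω₂`: `N = ∅`),
  `FK.reach_left_of_inter_subset_singleton` (one-vertex interface).
These drive the pair-state bookkeeping of the marked pair along the spine (file `…X2SpineSem`).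
[cite: Grimmett2006, §3.9 (p. 63)]
-/

namespace Summit.CriticalPhenomena.PercolationContinuityZ3.Theorems

namespace FK

open SimpleGraph Literature.Probability.LatticeModels Literature.Probability.Percolation
open scoped Classical

variable {V : Type*}

section Subst

variable {E₁ E₂ ω₁ ω₂ : Set (Sym2 V)} {V₁ V₂ : Set V} {a b : V}

/-- One hop through the second part between admissible end-points (`∈ V₁` or a terminal) is a hop along the virtual edge. [folklore] -/
theorem reach_virtual_of_reach_right (h₂ : ∀ e ∈ E₂, ∀ z ∈ e, z ∈ V₂) (hS : V₁ ∩ V₂ ⊆ {a, b}) (hω₂ : ω₂ ⊆ E₂)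
    {N : Set (Sym2 V)} (hN : (openGraph ω₂).Reachable a b → a ≠ b → s(a, b) ∈ N)
    {p p' : V} (hp : p ∈ V₁ ∨ p = a ∨ p = b) (hp' : p' ∈ V₁ ∨ p' = a ∨ p' = b) (h : (openGraph ω₂).Reachable p p') :
    (openGraph (ω₁ ∪ N)).Reachable p p' := by
  by_cases hpp : p = p'
  · subst hpp; exact Reachable.refl _
  · have hpV₂ : p ∈ V₂ := GZGluing.mem_of_reachable_ne h₂ hω₂ h hpp
    have hp'V₂ : p' ∈ V₂ := GZGluing.mem_of_reachable_ne h₂ hω₂ h.symm (Ne.symm hpp)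
    have hpab : p = a ∨ p = b := by
      rcases hp with hp | hp
      · simpa [Set.mem_insert_iff, Set.mem_singleton_iff] using hS ⟨hp, hpV₂⟩
      · exact hp
    have hp'ab : p' = a ∨ p' = b := by
      rcases hp' with hp' | hp'
      · simpa [Set.mem_insert_iff, Set.mem_singleton_iff] using hS ⟨hp', hp'V₂⟩
      · exact hp'
    -- so `{p, p'} = {a, b}`, `a ≠ b`, and `a ↔ b` in `ω₂`
    have key : ∀ {x y : V}, x ≠ y → (openGraph ω₂).Reachable x y → (x = a ∧ y = b) →
        (openGraph (ω₁ ∪ N)).Reachable x y := by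
      rintro x y hxy hr ⟨rfl, rfl⟩
      have he : s(x, y) ∈ N := hN hr hxy
      exact Adj.reachable ((openGraph_adj _ x y).2 ⟨Or.inr he, hxy⟩)
    rcases hpab with rfl | rfl <;> rcases hp'ab with rfl | rfl
    · exact absurd rfl hpp
    · exact key hpp h ⟨rfl, rfl⟩
    · exact (key (Ne.symm hpp) h.symm ⟨rfl, rfl⟩).symm
    · exact absurd rfl hpp

/-- **Two-terminal substitution.**  If the edges of `E₁` live on `V₁`, those of `E₂` on `V₂`, `V₁ ∩ V₂ ⊆ {a, b}`, and `N` contains the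
virtual edge `s(a, b)` whenever `a ↔ b` inside `ω₂ ⊆ E₂` (`a ≠ b`), then for `u, v ∈ V₁` and `ω₁ ⊆ E₁`: `u ↔ v` in `ω₁ ∪ ω₂` implies
`u ↔ v` in `ω₁ ∪ N` — the second part acts on the first like a switchable edge between the interface vertices. [folklore] -/
theorem reach_union_subst (h₁ : ∀ e ∈ E₁, ∀ z ∈ e, z ∈ V₁) (h₂ : ∀ e ∈ E₂, ∀ z ∈ e, z ∈ V₂) (hS : V₁ ∩ V₂ ⊆ {a, b})
    (hω₁ : ω₁ ⊆ E₁) (hω₂ : ω₂ ⊆ E₂) {N : Set (Sym2 V)} (hN : (openGraph ω₂).Reachable a b → a ≠ b → s(a, b) ∈ N)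
    {u v : V} (hu : u ∈ V₁) (hv : v ∈ V₁) (h : (openGraph (ω₁ ∪ ω₂)).Reachable u v) :
    (openGraph (ω₁ ∪ N)).Reachable u v := by
  obtain ⟨p⟩ := h
  -- split the walk at the separator `S = {a, b, v}`
  have hS' : V₁ ∩ V₂ ⊆ ({a, b, v} : Set V) := by
    intro z hz
    rcases hS hz with h | h
    · exact Or.inl h
    · exact Or.inr (Or.inl h)
  obtain ⟨s, hsS, hside, hchain⟩ := GZGluing.walk_split h₁ h₂ hS' hω₁ hω₂ p (by simp)
  -- members of `S` are admissible end-points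
  have adm : ∀ {z : V}, z ∈ ({a, b, v} : Set V) → z ∈ V₁ ∨ z = a ∨ z = b := by
    intro z hz
    simp only [Set.mem_insert_iff, Set.mem_singleton_iff] at hz
    rcases hz with rfl | rfl | rfl
    · exact Or.inr (Or.inl rfl)
    · exact Or.inr (Or.inr rfl)
    · exact Or.inl hv
  -- one-sided hops become hops in `ω₁ ∪ N`
  have hop : ∀ {x y : V}, (x ∈ V₁ ∨ x = a ∨ x = b) → (y ∈ V₁ ∨ y = a ∨ y = b) →
      ((openGraph ω₁).Reachable x y ∨ (openGraph ω₂).Reachable x y) → (openGraph (ω₁ ∪ N)).Reachable x y := by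
    intro x y hx hy hr
    rcases hr with hr | hr
    · exact hr.mono (openGraph_mono Set.subset_union_left)
    · exact reach_virtual_of_reach_right (ω₁ := ω₁) h₂ hS hω₂ hN hx hy hr
  have hA : ∀ x y, x ∈ ({w | (openGraph (ω₁ ∪ N)).Reachable u w} : Set V) →
      (x ∈ ({a, b, v} : Set V) ∧ y ∈ ({a, b, v} : Set V) ∧ ((openGraph ω₁).Reachable x y ∨ (openGraph ω₂).Reachable x y)) →
      y ∈ ({w | (openGraph (ω₁ ∪ N)).Reachable u w} : Set V) := by
    rintro x y hx ⟨hxS, hyS, hr⟩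
    exact Reachable.trans hx (hop (adm hxS) (adm hyS) hr)
  have hs : s ∈ ({w | (openGraph (ω₁ ∪ N)).Reachable u w} : Set V) := hop (Or.inl hu) (adm hsS) hside
  exact GZGluing.reflTransGen_mem hA hchain hs

/-- **Virtual edge**: `u ↔ v` in `ω₁ ∪ ω₂` implies `u ↔ v` in `ω₁ ∪ {ab}` (`u, v ∈ V₁`). [folklore] -/
theorem reach_union_virtual (h₁ : ∀ e ∈ E₁, ∀ z ∈ e, z ∈ V₁) (h₂ : ∀ e ∈ E₂, ∀ z ∈ e, z ∈ V₂) (hS : V₁ ∩ V₂ ⊆ {a, b})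
    (hω₁ : ω₁ ⊆ E₁) (hω₂ : ω₂ ⊆ E₂) {u v : V} (hu : u ∈ V₁) (hv : v ∈ V₁) (h : (openGraph (ω₁ ∪ ω₂)).Reachable u v) :
    (openGraph (ω₁ ∪ {s(a, b)})).Reachable u v :=
  reach_union_subst h₁ h₂ hS hω₁ hω₂ (fun _ _ => Set.mem_singleton _) hu hv h

/-- **Closed switch**: if `a ↮ b` inside `ω₂`, then `u ↔ v` in `ω₁ ∪ ω₂` implies `u ↔ v` in `ω₁` alone (`u, v ∈ V₁`). [folklore] -/
theorem reach_left_of_not_reach (h₁ : ∀ e ∈ E₁, ∀ z ∈ e, z ∈ V₁) (h₂ : ∀ e ∈ E₂, ∀ z ∈ e, z ∈ V₂) (hS : V₁ ∩ V₂ ⊆ {a, b})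
    (hω₁ : ω₁ ⊆ E₁) (hω₂ : ω₂ ⊆ E₂) (hab : ¬ (openGraph ω₂).Reachable a b) {u v : V} (hu : u ∈ V₁) (hv : v ∈ V₁)
    (h : (openGraph (ω₁ ∪ ω₂)).Reachable u v) : (openGraph ω₁).Reachable u v := by
  have key := reach_union_subst h₁ h₂ hS hω₁ hω₂ (N := ∅) (fun hr _ => absurd hr hab) hu hv h
  rwa [Set.union_empty] at key

/-- **One-vertex interface**: if the parts meet in at most one vertex `m`, then `u ↔ v` in `ω₁ ∪ ω₂` implies `u ↔ v` in `ω₁`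
(`u, v ∈ V₁`). [folklore] -/
theorem reach_left_of_inter_subset_singleton (h₁ : ∀ e ∈ E₁, ∀ z ∈ e, z ∈ V₁) (h₂ : ∀ e ∈ E₂, ∀ z ∈ e, z ∈ V₂) {m : V}
    (hS : V₁ ∩ V₂ ⊆ {m}) (hω₁ : ω₁ ⊆ E₁) (hω₂ : ω₂ ⊆ E₂) {u v : V} (hu : u ∈ V₁) (hv : v ∈ V₁)
    (h : (openGraph (ω₁ ∪ ω₂)).Reachable u v) : (openGraph ω₁).Reachable u v := by
  have hS' : V₁ ∩ V₂ ⊆ ({m, m} : Set V) := fun z hz => Or.inl (hS hz)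
  have key := reach_union_subst h₁ h₂ hS' hω₁ hω₂ (N := ∅) (fun _ hmm => absurd rfl hmm) hu hv h
  rwa [Set.union_empty] at key

end Subst

end FK

end Summit.CriticalPhenomena.PercolationContinuityZ3.Theorems
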